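import Literature.Dynamics.FractalDistributions.OctantSplittingEntropy
import HarnessLib

/-!
# Cube states of the CP-chain and the dictionary with the discrete octree chain

Topic `Literature/Dynamics/FractalDistributions`; follow-up to `OctantSplittingEntropy.lean`
(definition request `defn-OctantSplittingEntropy`, route
`CriticalPhenomena/Ising3DConformalLimit/OctantEntropy`), supplying the identification that the route's
layer-2 children (`ZoomErgodic`, `CoarseFurstenberg`) are typed with: the CP-chain of
`OctreeCPChain.lean` started at the lattice state `latticeState d K A` of a finite set of sites
`A ⊆ W_K = [-2^K, 2^K)^d` IS the mass-driven discrete octree chain of the counting measure of `A`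
(Furstenberg 2008 §1 / Furstenberg 2014 Ch. 5: the Markov process on the probability tree of mass
ratios), so that its mean splitting entropies are the discrete level entropies and add up over the
`K + 1` levels to `log₂ #A` exactly.

## Content (all definitions real, all lemmas proved, no named facts)

* `cubePoint n a x = (x - a)/2^n` (the window case is `latticePoint`, `cubePoint_window`),
  `cubePoint_mem_childCube_iff` (a site lands in the child `C_ε` of `[0,1)^d` iff it lies in the
  discrete child cube), `blowUp_cubePoint` (`blowUp ε ∘ cubePoint (n+1) a = cubePoint n (childCorner n a ε)`).
* `cubeMeasure m n a = ∑_{x ∈ Q} m(x) δ_{cubePoint n a x}` and the state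
  `cubeState m hm n a hM : CPState d` of nonnegative weights of positive mass on `Q = dyadicCube n a`;
  `toReal_cubeState_childCube` (child masses `= octantMass/mass`), `cpEntropy_cubeState_succ`
  (`𝓔(cubeState) = octantEntropy`), **`zoomState_cubeState`** (the CP step on a cube state is the
  step of the discrete chain: `(cubeState m (n+1) a)^{C_ε} = cubeState m n (childCorner n a ε)` for a
  child of positive mass), `latticeState_eq_cubeState`.
* Dirac states: `cpEntropy_eq_zero_of_eq_dirac`, `toMeasure_zoomState_of_eq_dirac`,
  `cpLevelEntropy_eq_zero_of_eq_dirac` (a single atom has zero entropy at every time).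
* **`cpLevelEntropy_cubeState`**: `(𝒯ᵏ𝓔)(cubeState m n a) = meanLevelEntropy m n a k`, by induction
  along the two first-step recursions (`cpLevelEntropy_succ`, `meanLevelEntropy_succ`);
  **`cpLevelEntropy_latticeState`** and **`sum_range_cpLevelEntropy_latticeState`**:
  `∑_{k=0}^{K} (𝒯ᵏ𝓔)(latticeState d K A) = log₂ #A` (Furstenberg 2014, Ch. 12, p. 46, the uniform
  tree: `(1/l) ∑_{j<l} 𝒯ʲ𝓔(Θ_l) = log N_l / l`), with the corollary `log₂ #A ≤ (K+1) d`.

## References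

* H. Furstenberg, *Ergodic Theory and Fractal Geometry*, CBMS 120, AMS (2014), Ch. 5, Ch. 11–12.
  [Furstenberg2014]
* H. Furstenberg, Ergodic fractal measures and dimension conservation, ETDS 28 (2008), §1–2.
  [Furstenberg2008]
* M. Hochman, P. Shmerkin, Local entropy averages and projections of fractal measures, Ann. of Math.
  175 (2012), §7.3–7.5 (the CP step `μ^B`). [HochmanShmerkin2012]
-/

noncomputable section

open scoped BigOperators ENNReal
open Finset Real

namespace Literature.Dynamics.FractalDistributions

/-! ## States of discrete cubes in the CP-chain and the bridge to the discrete chain -/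

section Lattice

open _root_.MeasureTheory

variable {d : ℕ}

/-- The point of `[0,1)^d` representing the site `x` of the discrete cube `dyadicCube n a`:
`x ↦ (x - a) / 2^n` coordinatewise (for the window, `a = -2^K` and `n = K + 1`, this is
`latticePoint d K`, `cubePoint_window`). [folklore] -/
def cubePoint (n : ℕ) (a x : Fin d → ℤ) : Fin d → ℝ := fun i => ((x i : ℝ) - a i) / 2 ^ n

/-- On the window `[-2^K, 2^K)^d` the cube coordinates are the `latticePoint`s of
`OctreeCPChain.lean`. [folklore] -/
theorem cubePoint_window (K : ℕ) (x : Fin d → ℤ) :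
    cubePoint (K + 1) (fun _ => -2 ^ K) x = latticePoint d K x := by
  funext i
  simp only [cubePoint, latticePoint, Int.cast_neg, Int.cast_pow, Int.cast_ofNat, sub_neg_eq_add]

/-- Sites of the cube are sent into the unit cube. [folklore] -/
theorem cubePoint_mem_unitCube {n : ℕ} {a x : Fin d → ℤ} (hx : x ∈ dyadicCube n a) :
    cubePoint n a x ∈ unitCube d := by
  rw [mem_dyadicCube] at hx
  intro i _
  simp only [cubePoint, Set.mem_Ico]
  have h2 : (0 : ℝ) < 2 ^ n := by positivity
  obtain ⟨h₁, h₂⟩ := hx i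
  have h₁' : (a i : ℝ) ≤ x i := by exact_mod_cast h₁
  have h₂' : (x i : ℝ) < a i + 2 ^ n := by exact_mod_cast h₂
  exact ⟨div_nonneg (by linarith) h2.le, (div_lt_one h2).2 (by linarith)⟩

/-- One coordinate of `cubePoint_mem_childCube_iff`. [folklore] -/
private theorem coord_mem_aux (n : ℕ) (lo x : ℤ) (b : ℕ) :
    ((b : ℝ) / 2 ≤ ((x : ℝ) - lo) / 2 ^ (n + 1) ∧ ((x : ℝ) - lo) / 2 ^ (n + 1) < ((b : ℝ) + 1) / 2) ↔
      (lo + 2 ^ n * (b : ℤ) ≤ x ∧ x < lo + 2 ^ n * (b : ℤ) + 2 ^ n) := by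
  have h2 : (0 : ℝ) < 2 ^ (n + 1) := by positivity
  rw [le_div_iff₀ h2, div_lt_iff₀ h2]
  have e1 : (b : ℝ) / 2 * 2 ^ (n + 1) = ((2 ^ n * (b : ℤ) : ℤ) : ℝ) := by push_cast; ring
  have e2 : ((b : ℝ) + 1) / 2 * 2 ^ (n + 1) = ((2 ^ n * (b : ℤ) + 2 ^ n : ℤ) : ℝ) := by push_cast; ring
  have e3 : ((x : ℝ) - lo) = ((x - lo : ℤ) : ℝ) := by push_cast; ring
  rw [e1, e2, e3, Int.cast_le, Int.cast_lt]
  constructor <;> rintro ⟨h₁, h₂⟩ <;> constructor <;> linarith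

/-- A site of `ℤ^d` is sent by `cubePoint (n+1) a` into the child `C_ε` of the unit cube iff it lies in
the discrete child cube `dyadicCube n (childCorner n a ε)`. [folklore] -/
theorem cubePoint_mem_childCube_iff (n : ℕ) (a x : Fin d → ℤ) (ε : Octant d) :
    cubePoint (n + 1) a x ∈ childCube d ε ↔ x ∈ dyadicCube n (childCorner n a ε) := by
  simp only [childCube, Set.mem_univ_pi, Set.mem_Ico, cubePoint, mem_dyadicCube, childCorner]
  exact forall_congr' fun i => coord_mem_aux n (a i) (x i) (ε i)

/-- The blow-up of the child `C_ε` carries the level-`(n+1)` coordinates of a site to its level-`n`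
coordinates in the child cube: `blowUp ε ∘ cubePoint (n+1) a = cubePoint n (childCorner n a ε)`.
[folklore] -/
theorem blowUp_cubePoint (n : ℕ) (a x : Fin d → ℤ) (ε : Octant d) :
    blowUp d ε (cubePoint (n + 1) a x) = cubePoint n (childCorner n a ε) x := by
  funext i
  simp only [blowUp, cubePoint, childCorner]
  push_cast
  field_simp
  ring

/-- The atomic measure `∑_{x ∈ Q} m(x) δ_{p(x)}` of the weights `m` on the cube `Q = dyadicCube n a`,
placed in `[0,1)^d` by `p = cubePoint n a`. [folklore] -/
def cubeMeasure (m : (Fin d → ℤ) → ℝ) (n : ℕ) (a : Fin d → ℤ) : Measure (Fin d → ℝ) :=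
  ∑ x ∈ dyadicCube n a, ENNReal.ofReal (m x) • Measure.dirac (cubePoint n a x)

/-- Values of `cubeMeasure`. [folklore] -/
theorem cubeMeasure_apply (m : (Fin d → ℤ) → ℝ) (n : ℕ) (a : Fin d → ℤ) {s : Set (Fin d → ℝ)}
    (hs : MeasurableSet s) :
    cubeMeasure m n a s =
      ∑ x ∈ dyadicCube n a, ENNReal.ofReal (m x) * s.indicator 1 (cubePoint n a x) := by
  simp only [cubeMeasure, Measure.coe_finsetSum, Measure.coe_smul, Finset.sum_apply, Pi.smul_apply,
    Measure.dirac_apply' _ hs, smul_eq_mul]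

/-- Total mass of `cubeMeasure` (all atoms lie in the unit cube). [folklore] -/
theorem cubeMeasure_unitCube (m : (Fin d → ℤ) → ℝ) (hm : ∀ x, 0 ≤ m x) (n : ℕ) (a : Fin d → ℤ) :
    cubeMeasure m n a (unitCube d) = ENNReal.ofReal (∑ x ∈ dyadicCube n a, m x) := by
  rw [cubeMeasure_apply m n a measurableSet_unitCube, ENNReal.ofReal_sum_of_nonneg fun x _ => hm x]
  exact Finset.sum_congr rfl fun x hx => by
    rw [Set.indicator_of_mem (cubePoint_mem_unitCube hx), Pi.one_apply, mul_one]

/-- Total mass of `cubeMeasure`. [folklore] -/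
theorem cubeMeasure_univ (m : (Fin d → ℤ) → ℝ) (hm : ∀ x, 0 ≤ m x) (n : ℕ) (a : Fin d → ℤ) :
    cubeMeasure m n a Set.univ = ENNReal.ofReal (∑ x ∈ dyadicCube n a, m x) := by
  rw [cubeMeasure_apply m n a MeasurableSet.univ, ENNReal.ofReal_sum_of_nonneg fun x _ => hm x]
  exact Finset.sum_congr rfl fun x _ => by rw [Set.indicator_univ, Pi.one_apply, mul_one]

/-- The mass of the child `C_ε` under the level-`(n+1)` cube measure is the discrete child mass
`octantMass m n a ε`. [folklore] -/
theorem cubeMeasure_succ_childCube (m : (Fin d → ℤ) → ℝ) (hm : ∀ x, 0 ≤ m x) (n : ℕ)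
    (a : Fin d → ℤ) (ε : Octant d) :
    cubeMeasure m (n + 1) a (childCube d ε) = ENNReal.ofReal (octantMass m n a ε) := by
  rw [cubeMeasure_apply m (n + 1) a (measurableSet_childCube ε), octantMass,
    ENNReal.ofReal_sum_of_nonneg fun x _ => hm x]
  have key : ∀ x ∈ dyadicCube (n + 1) a,
      ENNReal.ofReal (m x) * (childCube d ε).indicator 1 (cubePoint (n + 1) a x) =
        if x ∈ dyadicCube n (childCorner n a ε) then ENNReal.ofReal (m x) else 0 := by
    intro x _
    by_cases h : x ∈ dyadicCube n (childCorner n a ε)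
    · rw [if_pos h, Set.indicator_of_mem ((cubePoint_mem_childCube_iff n a x ε).2 h), Pi.one_apply,
        mul_one]
    · rw [if_neg h, Set.indicator_of_notMem fun h' => h ((cubePoint_mem_childCube_iff n a x ε).1 h'),
        mul_zero]
  rw [Finset.sum_congr rfl key, ← Finset.sum_filter, Finset.filter_mem_eq_inter,
    Finset.inter_eq_right.2 (dyadicCube_childCorner_subset n a ε)]

/-- Zooming into the child `C_ε`: the level-`(n+1)` cube measure seen through `blowUp ε` on `C_ε` is
the level-`n` cube measure of the child cube. [folklore] -/
theorem cubeMeasure_succ_preimage_blowUp_inter (m : (Fin d → ℤ) → ℝ) (n : ℕ) (a : Fin d → ℤ)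
    (ε : Octant d) {s : Set (Fin d → ℝ)} (hs : MeasurableSet s) :
    cubeMeasure m (n + 1) a (blowUp d ε ⁻¹' s ∩ childCube d ε) =
      cubeMeasure m n (childCorner n a ε) s := by
  rw [cubeMeasure_apply _ _ _ ((measurable_blowUp ε hs).inter (measurableSet_childCube ε)),
    cubeMeasure_apply _ _ _ hs]
  have key : ∀ x ∈ dyadicCube (n + 1) a,
      ENNReal.ofReal (m x) * (blowUp d ε ⁻¹' s ∩ childCube d ε).indicator 1 (cubePoint (n + 1) a x) =
        if x ∈ dyadicCube n (childCorner n a ε) then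
          ENNReal.ofReal (m x) * s.indicator 1 (cubePoint n (childCorner n a ε) x) else 0 := by
    intro x _
    by_cases h : x ∈ dyadicCube n (childCorner n a ε)
    · rw [if_pos h]
      have hC : cubePoint (n + 1) a x ∈ childCube d ε := (cubePoint_mem_childCube_iff n a x ε).2 h
      by_cases h' : cubePoint n (childCorner n a ε) x ∈ s
      · have h'' : cubePoint (n + 1) a x ∈ blowUp d ε ⁻¹' s := by
          rw [Set.mem_preimage, blowUp_cubePoint]
          exact h'
        rw [Set.indicator_of_mem h', Set.indicator_of_mem (Set.mem_inter h'' hC), Pi.one_apply, Pi.one_apply]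
      · have h'' : cubePoint (n + 1) a x ∉ blowUp d ε ⁻¹' s ∩ childCube d ε := fun hx' =>
          h' (by rw [← blowUp_cubePoint]; exact hx'.1)
        rw [Set.indicator_of_notMem h', Set.indicator_of_notMem h'']
    · rw [if_neg h, Set.indicator_of_notMem fun h' => h ((cubePoint_mem_childCube_iff n a x ε).1 h'.2),
        mul_zero]
  rw [Finset.sum_congr rfl key, ← Finset.sum_filter, Finset.filter_mem_eq_inter,
    Finset.inter_eq_right.2 (dyadicCube_childCorner_subset n a ε)]

/-- **The state of a weighted discrete cube**: for nonnegative site weights `m` with positive total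
mass on `Q = dyadicCube n a`, the normalised atomic measure `μ(Q)⁻¹ ∑_{x ∈ Q} m(x) δ_{p(x)}` on
`[0,1)^d` — the state from which the CP-chain of `OctreeCPChain.lean` reproduces the mass-driven
discrete chain (`zoomState_cubeState`, `cpLevelEntropy_cubeState`); `latticeState d K A` is the case
`m = 𝟙_A`, `Q` the window (`latticeState_eq_cubeState`). [folklore] -/
def cubeState (m : (Fin d → ℤ) → ℝ) (hm : ∀ x, 0 ≤ m x) (n : ℕ) (a : Fin d → ℤ)
    (hM : 0 < ∑ x ∈ dyadicCube n a, m x) : CPState d :=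
  ⟨⟨(ENNReal.ofReal (∑ x ∈ dyadicCube n a, m x))⁻¹ • cubeMeasure m n a, ⟨by
      rw [Measure.smul_apply, smul_eq_mul, cubeMeasure_univ m hm n a]
      exact ENNReal.inv_mul_cancel (ENNReal.ofReal_pos.2 hM).ne' ENNReal.ofReal_ne_top⟩⟩, by
      change ((ENNReal.ofReal (∑ x ∈ dyadicCube n a, m x))⁻¹ • cubeMeasure m n a) (unitCube d) = 1
      rw [Measure.smul_apply, smul_eq_mul, cubeMeasure_unitCube m hm n a]
      exact ENNReal.inv_mul_cancel (ENNReal.ofReal_pos.2 hM).ne' ENNReal.ofReal_ne_top⟩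

/-- The underlying measure of `cubeState` (definitional). [folklore] -/
theorem toMeasure_cubeState (m : (Fin d → ℤ) → ℝ) (hm : ∀ x, 0 ≤ m x) (n : ℕ) (a : Fin d → ℤ)
    (hM : 0 < ∑ x ∈ dyadicCube n a, m x) :
    (cubeState m hm n a hM : Measure (Fin d → ℝ)) =
      (ENNReal.ofReal (∑ x ∈ dyadicCube n a, m x))⁻¹ • cubeMeasure m n a := rfl

/-- A cube of level `0` is a single site: its state is the Dirac mass at the origin's image.
[folklore] -/
theorem toMeasure_cubeState_zero (m : (Fin d → ℤ) → ℝ) (hm : ∀ x, 0 ≤ m x) (a : Fin d → ℤ)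
    (hM : 0 < ∑ x ∈ dyadicCube 0 a, m x) :
    (cubeState m hm 0 a hM : Measure (Fin d → ℝ)) = Measure.dirac (cubePoint 0 a a) := by
  have hM' := hM
  rw [dyadicCube_zero, Finset.sum_singleton] at hM'
  rw [toMeasure_cubeState, cubeMeasure, dyadicCube_zero, Finset.sum_singleton, Finset.sum_singleton,
    smul_smul, ENNReal.inv_mul_cancel (ENNReal.ofReal_pos.2 hM').ne' ENNReal.ofReal_ne_top, one_smul]

/-- The child masses of a cube state are the normalised discrete child masses
`μ(Q_ε)/μ(Q)`. [folklore] -/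
theorem toReal_cubeState_childCube (m : (Fin d → ℤ) → ℝ) (hm : ∀ x, 0 ≤ m x) (n : ℕ)
    (a : Fin d → ℤ) (hM : 0 < ∑ x ∈ dyadicCube (n + 1) a, m x) (ε : Octant d) :
    ((cubeState m hm (n + 1) a hM : Measure (Fin d → ℝ)) (childCube d ε)).toReal =
      octantMass m n a ε / ∑ x ∈ dyadicCube (n + 1) a, m x := by
  rw [toMeasure_cubeState, Measure.smul_apply, smul_eq_mul, cubeMeasure_succ_childCube m hm n a ε,
    ENNReal.toReal_mul, ENNReal.toReal_inv, ENNReal.toReal_ofReal hM.le,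
    ENNReal.toReal_ofReal (octantMass_nonneg hm n a ε), inv_mul_eq_div]

/-- The octant-splitting entropy of a cube state is the discrete octant-splitting entropy:
`𝓔(cubeState m (n+1) a) = H_{2^d}(m, dyadicCube (n+1) a)`. [folklore] -/
theorem cpEntropy_cubeState_succ (m : (Fin d → ℤ) → ℝ) (hm : ∀ x, 0 ≤ m x) (n : ℕ) (a : Fin d → ℤ)
    (hM : 0 < ∑ x ∈ dyadicCube (n + 1) a, m x) :
    cpEntropy (cubeState m hm (n + 1) a hM) = octantEntropy m n a := by
  rw [cpEntropy, octantEntropy,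
    ← splittingEntropy_mul_left univ (octantMass m n a) (inv_ne_zero hM.ne')]
  exact splittingEntropy_congr fun ε _ => by rw [toReal_cubeState_childCube, div_eq_inv_mul]

/-- **Zooming a cube state gives the cube state of the child**: for a child of positive mass,
`(cubeState m (n+1) a)^{C_ε} = cubeState m n (childCorner n a ε)` — the CP step IS the step of the
mass-driven discrete chain. [folklore] -/
theorem zoomState_cubeState (m : (Fin d → ℤ) → ℝ) (hm : ∀ x, 0 ≤ m x) (n : ℕ) (a : Fin d → ℤ)
    (hM : 0 < ∑ x ∈ dyadicCube (n + 1) a, m x) (ε : Octant d) (hε : 0 < octantMass m n a ε) :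
    zoomState d (cubeState m hm (n + 1) a hM) ε = cubeState m hm n (childCorner n a ε) hε := by
  apply Subtype.ext
  apply ProbabilityMeasure.toMeasure_injective
  change zoomMeasure d ((ENNReal.ofReal (∑ x ∈ dyadicCube (n + 1) a, m x))⁻¹ • cubeMeasure m (n + 1) a) ε
    = (ENNReal.ofReal (octantMass m n a ε))⁻¹ • cubeMeasure m n (childCorner n a ε)
  have hA0 : ENNReal.ofReal (∑ x ∈ dyadicCube (n + 1) a, m x) ≠ 0 := (ENNReal.ofReal_pos.2 hM).ne'
  have hB0 : ENNReal.ofReal (octantMass m n a ε) ≠ 0 := (ENNReal.ofReal_pos.2 hε).ne'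
  have hC : ((ENNReal.ofReal (∑ x ∈ dyadicCube (n + 1) a, m x))⁻¹ • cubeMeasure m (n + 1) a)
      (childCube d ε) =
      (ENNReal.ofReal (∑ x ∈ dyadicCube (n + 1) a, m x))⁻¹ * ENNReal.ofReal (octantMass m n a ε) := by
    rw [Measure.smul_apply, smul_eq_mul, cubeMeasure_succ_childCube m hm n a ε]
  have hCne : ((ENNReal.ofReal (∑ x ∈ dyadicCube (n + 1) a, m x))⁻¹ • cubeMeasure m (n + 1) a)
      (childCube d ε) ≠ 0 := by
    rw [hC]
    exact mul_ne_zero (ENNReal.inv_ne_zero.2 ENNReal.ofReal_ne_top) hB0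
  ext s hs
  rw [zoomMeasure_apply _ ε hs, if_neg hCne, hC, Measure.smul_apply, Measure.smul_apply, smul_eq_mul,
    smul_eq_mul, cubeMeasure_succ_preimage_blowUp_inter m n a ε hs,
    ENNReal.mul_inv (Or.inr ENNReal.ofReal_ne_top) (Or.inr hB0), inv_inv]
  calc ENNReal.ofReal (∑ x ∈ dyadicCube (n + 1) a, m x) * (ENNReal.ofReal (octantMass m n a ε))⁻¹ *
        ((ENNReal.ofReal (∑ x ∈ dyadicCube (n + 1) a, m x))⁻¹ *
          cubeMeasure m n (childCorner n a ε) s)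
      = ENNReal.ofReal (∑ x ∈ dyadicCube (n + 1) a, m x) *
          (ENNReal.ofReal (∑ x ∈ dyadicCube (n + 1) a, m x))⁻¹ *
          ((ENNReal.ofReal (octantMass m n a ε))⁻¹ * cubeMeasure m n (childCorner n a ε) s) := by
        ring
    _ = (ENNReal.ofReal (octantMass m n a ε))⁻¹ * cubeMeasure m n (childCorner n a ε) s := by
        rw [ENNReal.mul_inv_cancel hA0 ENNReal.ofReal_ne_top, one_mul]

/-- A family of weights carried by a single cell has zero splitting entropy. [folklore] -/
theorem splittingEntropy_eq_zero_of_forall_ne {α : Type*} {s : Finset α} {w : α → ℝ} (x₀ : α)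
    (h : ∀ x ∈ s, x ≠ x₀ → w x = 0) : splittingEntropy s w = 0 := by
  unfold splittingEntropy
  rw [Finset.sum_eq_zero, zero_div]
  intro x hx
  by_cases hx0 : x = x₀
  · subst hx0
    have hW : ∑ y ∈ s, w y = w x :=
      Finset.sum_eq_single x (fun y hy hne => h y hy hne) fun hxs => absurd hx hxs
    rw [hW]
    by_cases hw : w x = 0
    · rw [hw, zero_div, negMulLog_zero]
    · rw [div_self hw, negMulLog_one]
  · rw [h x hx hx0, zero_div, negMulLog_zero]

/-- A Dirac state has zero octant-splitting entropy (one child carries all the mass). [folklore] -/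
theorem cpEntropy_eq_zero_of_eq_dirac (θ : CPState d) {y : Fin d → ℝ}
    (hθ : (θ : Measure (Fin d → ℝ)) = Measure.dirac y) : cpEntropy θ = 0 := by
  have hy : y ∈ unitCube d := by
    by_contra hy
    have h1 := θ.measure_unitCube
    rw [hθ, Measure.dirac_apply' _ measurableSet_unitCube, Set.indicator_of_notMem hy] at h1
    exact zero_ne_one h1
  obtain ⟨ε₀, h₀⟩ := exists_mem_childCube_of_mem_unitCube hy
  refine splittingEntropy_eq_zero_of_forall_ne ε₀ fun ε _ hne => ?_
  have hyε : y ∉ childCube d ε := fun h => Set.disjoint_left.1 (disjoint_childCube hne) h h₀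
  change ((θ : Measure (Fin d → ℝ)) (childCube d ε)).toReal = 0
  rw [hθ, Measure.dirac_apply' _ (measurableSet_childCube ε), Set.indicator_of_notMem hyε,
    ENNReal.toReal_zero]

/-- Zooming a Dirac state into the child containing its atom gives the Dirac state at the blown-up
atom. [folklore] -/
theorem toMeasure_zoomState_of_eq_dirac (θ : CPState d) {y : Fin d → ℝ}
    (hθ : (θ : Measure (Fin d → ℝ)) = Measure.dirac y) {ε : Octant d} (hy : y ∈ childCube d ε) :
    (zoomState d θ ε : Measure (Fin d → ℝ)) = Measure.dirac (blowUp d ε y) := by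
  rw [CPState.toMeasure_zoomState, hθ]
  have h1 : Measure.dirac y (childCube d ε) = 1 := by
    rw [Measure.dirac_apply' _ (measurableSet_childCube ε), Set.indicator_of_mem hy, Pi.one_apply]
  ext s hs
  rw [zoomMeasure_apply _ ε hs, if_neg (by rw [h1]; exact one_ne_zero), h1, inv_one, one_mul,
    Measure.dirac_apply' _ hs,
    Measure.dirac_apply' _ ((measurable_blowUp ε hs).inter (measurableSet_childCube ε))]
  by_cases h : blowUp d ε y ∈ s
  · rw [Set.indicator_of_mem h, Set.indicator_of_mem (show y ∈ blowUp d ε ⁻¹' s ∩ childCube d ε from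
      ⟨h, hy⟩), Pi.one_apply, Pi.one_apply]
  · rw [Set.indicator_of_notMem h,
      Set.indicator_of_notMem (show y ∉ blowUp d ε ⁻¹' s ∩ childCube d ε from fun h' => h h'.1)]

/-- **A single atom has zero mean splitting entropy at every time**: the CP-chain started at a Dirac
state stays Dirac. [folklore] -/
theorem cpLevelEntropy_eq_zero_of_eq_dirac :
    ∀ (k : ℕ) (θ : CPState d) (y : Fin d → ℝ),
      (θ : Measure (Fin d → ℝ)) = Measure.dirac y → cpLevelEntropy θ k = 0
  | 0, θ, y, hθ => by
    rw [cpLevelEntropy_zero]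
    exact cpEntropy_eq_zero_of_eq_dirac θ hθ
  | k + 1, θ, y, hθ => by
    rw [cpLevelEntropy_succ]
    refine Finset.sum_eq_zero fun ε _ => ?_
    by_cases hy : y ∈ childCube d ε
    · rw [cpLevelEntropy_eq_zero_of_eq_dirac k _ _ (toMeasure_zoomState_of_eq_dirac θ hθ hy),
        mul_zero]
    · rw [hθ, Measure.dirac_apply' _ (measurableSet_childCube ε), Set.indicator_of_notMem hy,
        ENNReal.toReal_zero, zero_mul]

/-- **The CP-chain started at a cube state is the mass-driven discrete chain**: its mean splitting
entropy at time `k` is the discrete mean level-`k` entropy, `(𝒯ᵏ𝓔)(cubeState m n a) = h_k(m, n, a)`.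
[folklore] -/
theorem cpLevelEntropy_cubeState (m : (Fin d → ℤ) → ℝ) (hm : ∀ x, 0 ≤ m x) :
    ∀ (n : ℕ) (a : Fin d → ℤ) (hM : 0 < ∑ x ∈ dyadicCube n a, m x) (k : ℕ),
      cpLevelEntropy (cubeState m hm n a hM) k = meanLevelEntropy m n a k
  | 0, a, hM, k => by
    rw [meanLevelEntropy_level_zero]
    exact cpLevelEntropy_eq_zero_of_eq_dirac k _ (cubePoint 0 a a) (toMeasure_cubeState_zero m hm a hM)
  | n + 1, a, hM, 0 => by
    rw [cpLevelEntropy_zero, meanLevelEntropy_zero]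
    exact cpEntropy_cubeState_succ m hm n a hM
  | n + 1, a, hM, k + 1 => by
    rw [cpLevelEntropy_succ, meanLevelEntropy_succ]
    refine Finset.sum_congr rfl fun ε _ => ?_
    rw [toReal_cubeState_childCube m hm n a hM ε]
    by_cases hε : 0 < octantMass m n a ε
    · rw [zoomState_cubeState m hm n a hM ε hε, cpLevelEntropy_cubeState m hm n (childCorner n a ε) hε k]
    · have h0 : octantMass m n a ε = 0 := le_antisymm (not_lt.1 hε) (octantMass_nonneg hm n a ε)
      rw [h0, zero_div, zero_mul, zero_mul]

/-- On the window `W_K = [-2^K, 2^K)^d` (= `dyadicCube (K+1) (-2^K)`), the counting weights of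
`A ⊆ W_K` have total mass `#A`. [folklore] -/
theorem sum_indicator_window (K : ℕ) (A : Finset (Fin d → ℤ))
    (hAW : A ⊆ dyadicCube (K + 1) (fun _ => -2 ^ K)) :
    ∑ x ∈ dyadicCube (K + 1) (fun _ => -2 ^ K), (if x ∈ A then (1 : ℝ) else 0) = #A := by
  rw [Finset.sum_boole, Finset.filter_mem_eq_inter, Finset.inter_eq_right.2 hAW]

/-- The lattice measure of `OctreeCPChain.lean` is the normalised cube measure of the counting
weights of `A` on the window. [folklore] -/
theorem latticeMeasure_eq (K : ℕ) (A : Finset (Fin d → ℤ))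
    (hAW : A ⊆ dyadicCube (K + 1) (fun _ => -2 ^ K)) :
    latticeMeasure d K A =
      (ENNReal.ofReal (∑ x ∈ dyadicCube (K + 1) (fun _ => -2 ^ K), if x ∈ A then (1 : ℝ) else 0))⁻¹ •
        cubeMeasure (fun x => if x ∈ A then (1 : ℝ) else 0) (K + 1) (fun _ => -2 ^ K) := by
  have hmeas : cubeMeasure (fun x => if x ∈ A then (1 : ℝ) else 0) (K + 1) (fun _ => -2 ^ K) =
      ∑ u ∈ A, Measure.dirac (latticePoint d K u) := by
    unfold cubeMeasure
    have key : ∀ x ∈ dyadicCube (K + 1) (fun _ => (-2 ^ K : ℤ)),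
        ENNReal.ofReal (if x ∈ A then (1 : ℝ) else 0) •
            Measure.dirac (cubePoint (K + 1) (fun _ => -2 ^ K) x) =
          if x ∈ A then Measure.dirac (latticePoint d K x) else 0 := by
      intro x _
      split_ifs
      · rw [ENNReal.ofReal_one, one_smul, cubePoint_window]
      · rw [ENNReal.ofReal_zero, zero_smul]
    rw [Finset.sum_congr rfl key, ← Finset.sum_filter, Finset.filter_mem_eq_inter,
      Finset.inter_eq_right.2 hAW]
  rw [sum_indicator_window K A hAW, hmeas, ENNReal.ofReal_natCast, latticeMeasure]

/-- **`latticeState` is a cube state**: the state of the finite set `A ⊆ W_K` at level `K` is the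
cube state of the counting weights `𝟙_A` on the window `dyadicCube (K+1) (-2^K)`. [folklore] -/
theorem latticeState_eq_cubeState (K : ℕ) (A : Finset (Fin d → ℤ)) (hA : A.Nonempty)
    (hW : ∀ u ∈ A, ∀ i, -(2 ^ K : ℤ) ≤ u i ∧ u i < 2 ^ K)
    (hM : 0 < ∑ x ∈ dyadicCube (K + 1) (fun _ => -2 ^ K), (fun x => if x ∈ A then (1 : ℝ) else 0) x) :
    latticeState d K A hA hW =
      cubeState (fun x => if x ∈ A then (1 : ℝ) else 0) (fun x => by positivity) (K + 1)
        (fun _ => -2 ^ K) hM := by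
  have hAW : A ⊆ dyadicCube (K + 1) (fun _ => -2 ^ K) := fun u hu => mem_dyadicCube_window.2 (hW u hu)
  apply Subtype.ext
  apply ProbabilityMeasure.toMeasure_injective
  exact latticeMeasure_eq K A hAW

/-- **Dictionary, level by level**: the mean splitting entropy at time `k` of the CP-chain started at
`latticeState d K A` is the discrete mean level-`k` octant entropy of the counting measure of `A` on
the window `[-2^K, 2^K)^d`. [folklore] -/
theorem cpLevelEntropy_latticeState (K : ℕ) (A : Finset (Fin d → ℤ)) (hA : A.Nonempty)
    (hW : ∀ u ∈ A, ∀ i, -(2 ^ K : ℤ) ≤ u i ∧ u i < 2 ^ K) (k : ℕ) :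
    cpLevelEntropy (latticeState d K A hA hW) k =
      meanLevelEntropy (fun x => if x ∈ A then (1 : ℝ) else 0) (K + 1) (fun _ => -2 ^ K) k := by
  have hAW : A ⊆ dyadicCube (K + 1) (fun _ => -2 ^ K) := fun u hu => mem_dyadicCube_window.2 (hW u hu)
  have hM : 0 < ∑ x ∈ dyadicCube (K + 1) (fun _ => -2 ^ K),
      (fun x => if x ∈ A then (1 : ℝ) else 0) x := by
    simp only [sum_indicator_window K A hAW]
    exact_mod_cast hA.card_pos
  rw [latticeState_eq_cubeState K A hA hW hM]
  exact cpLevelEntropy_cubeState _ _ (K + 1) _ hM k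

/-- **Dictionary, summed (the route's `log₂ mass_K = ∑_{k=0}^{K} h_k`)**: along the CP-chain started
at the lattice state of a finite non-empty `A ⊆ [-2^K, 2^K)^d ∩ ℤ^d`, the mean splitting entropies at
times `0, …, K` add up EXACTLY to `log₂ #A`. [cite: Furstenberg2014, Ch. 12, p. 46] -/
theorem sum_range_cpLevelEntropy_latticeState (K : ℕ) (A : Finset (Fin d → ℤ)) (hA : A.Nonempty)
    (hW : ∀ u ∈ A, ∀ i, -(2 ^ K : ℤ) ≤ u i ∧ u i < 2 ^ K) :
    ∑ k ∈ range (K + 1), cpLevelEntropy (latticeState d K A hA hW) k = Real.logb 2 #A := by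
  have hAW : A ⊆ dyadicCube (K + 1) (fun _ => -2 ^ K) := fun u hu => mem_dyadicCube_window.2 (hW u hu)
  simp only [cpLevelEntropy_latticeState]
  exact sum_range_meanLevelEntropy_indicator A (K + 1) _ hAW

/-- Hence the Cesàro mean of the level entropies of a lattice state is `log₂ #A / (K+1) ≤ d`, and the
quantity `E[log₂ mass_K]/(K+1)` of the route is a mean octant entropy per level. [folklore] -/
theorem sum_range_cpLevelEntropy_latticeState_le (K : ℕ) (A : Finset (Fin d → ℤ)) (hA : A.Nonempty)
    (hW : ∀ u ∈ A, ∀ i, -(2 ^ K : ℤ) ≤ u i ∧ u i < 2 ^ K) :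
    Real.logb 2 #A ≤ (K + 1) * d := by
  rw [← sum_range_cpLevelEntropy_latticeState K A hA hW]
  calc ∑ k ∈ range (K + 1), cpLevelEntropy (latticeState d K A hA hW) k
      ≤ ∑ _k ∈ range (K + 1), (d : ℝ) := Finset.sum_le_sum fun k _ => cpLevelEntropy_le _ k
    _ = (K + 1) * d := by rw [Finset.sum_const, Finset.card_range, nsmul_eq_mul, Nat.cast_add, Nat.cast_one]

end Lattice

end Literature.Dynamics.FractalDistributions

end
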